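import Summits.QuantumAdvantage.QuantumAdvantage.Theorems.CubicForrelationNearExactIsExactKtHalfStructure

/-!
# Crux `CubicForrelation.NearExactIsExact` (stmt-QuantumAdvantage-14043) — two analytic inputs of the bent-side `L¹` test
  (the bentness identity `2^m·#S ≤ Σ_y |Σ_{x∈S} (−1)^{d(x)+x·y}|`, and the plateau bound `T·Σ|D| ≤ Σ D²`)

Certificate seat `b2b-cforr-cert` (gen 44).  HONEST FRAMING: two elementary, uniform-in-`n` LEMMAS (standard axioms) — the analytic half of the
`(T2)`/`L¹` test of the bent-side analysis (DISPROOF.md §18.1–18.2: "BENTNESS IDENTITY: `D(y) := Σ_{x∈S}(−1)^{d(x)+x·y}` has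
`Σ_y (−1)^{g(y)} D(y) = 2^m|S|`, hence `Σ_y |D(y)| ≥ 2^m |S|`"), isolated here so that the `n = 14` line `Φ = 29/32` (§18.6(a)) — whose
combinatorial half is now served by `kh_structure_rm5_fourteen_768` (…KtHalfStructure) — reduces to the structural statement
"`f|_S = A₀A₁A₂ ⊕ affine`" (see the successor plan in HOME/b2b-cforr-cert-g44/LEAN-GEN44.md).  NOT summit progress; nothing about `θ₁₄`.

* `kb_bent_l1`: if `W_g = 2^m·(−1)^d` (e.g. `g` bent with dual `d`), then for EVERY finite set `S` of points,
  `2^m·#S ≤ Σ_y |Σ_{x∈S} (−1)^{d(x)} (−1)^{x·y}|` (expand `Σ_y (−1)^{g(y)} D(y) = Σ_{x∈S} (−1)^{d(x)} W_g(x) = 2^m #S` and bound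
  `(−1)^{g(y)} ≤ 1`).
* `kb_l1_le_of_gap`: if every value of `D` is `0` or at least `T > 0` in absolute value, then `T·Σ|D| ≤ Σ D²` — the form in which a
  "plateaued" partial transform (`D(y) ∈ {0, ±T}`) meets Parseval.

References: T. Kasami, N. Tokura (1970) (context only); O. S. Rothaus, *On "bent" functions*, JCT A 20 (1976) 300–305 (duality
`W_g = 2^m(−1)^{g̃}`); DISPROOF.md §18.1.  Axioms: the standard three.
-/

set_option linter.dupNamespace false -- D-0017: single-problem summit ⇒ `QuantumAdvantage.QuantumAdvantage` by design

noncomputable section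

namespace Summit.QuantumAdvantage.QuantumAdvantage.Theorems.CubicForrelation.NearExactIsExact

open Finset
open Literature.Computability.QuantumComplexity
open Literature.Computability.QuantumComplexity.BuzetChailloux (signOf_sq)
open Literature.Computability.QuantumComplexity.DerivativeWalsh (W)

variable {n : ℕ}

/-- **The bentness identity in `L¹` form.**  If `W_g(x) = 2^m·(−1)^{d(x)}` for all `x`, then for every set `S` of points,
`2^m·#S ≤ Σ_y |Σ_{x∈S} (−1)^{d(x)}(−1)^{x·y}|`: indeed `Σ_y (−1)^{g(y)}·Σ_{x∈S}(−1)^{d(x)+x·y} = Σ_{x∈S}(−1)^{d(x)} W_g(x) = 2^m·#S`.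
[this work; cite: Rothaus1976] -/
theorem kb_bent_l1 {m : ℕ} (g d : (Fin n → Bool) → Bool) (hd : ∀ x, W (fun y => signOf (g y)) x = (2 : ℝ) ^ m * signOf (d x))
    (S : Finset (Fin n → Bool)) :
    (2 : ℝ) ^ m * #S ≤ ∑ y, |∑ x ∈ S, signOf (d x) * twist x y| := by
  have key : ∑ y, signOf (g y) * ∑ x ∈ S, signOf (d x) * twist x y = (2 : ℝ) ^ m * #S := by
    calc ∑ y, signOf (g y) * ∑ x ∈ S, signOf (d x) * twist x y
        = ∑ x ∈ S, signOf (d x) * ∑ y, signOf (g y) * twist y x := by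
          simp_rw [mul_sum]
          rw [sum_comm]
          refine sum_congr rfl fun x _ => sum_congr rfl fun y _ => ?_
          rw [twist_comm x y]; ring
      _ = ∑ x ∈ S, signOf (d x) * ((2 : ℝ) ^ m * signOf (d x)) := by
          refine sum_congr rfl fun x _ => ?_
          rw [← hd x]; rfl
      _ = ∑ _x ∈ S, (2 : ℝ) ^ m := by
          refine sum_congr rfl fun x _ => ?_
          have := signOf_sq (d x)
          calc signOf (d x) * ((2 : ℝ) ^ m * signOf (d x)) = 2 ^ m * signOf (d x) ^ 2 := by ring
            _ = 2 ^ m := by rw [this, mul_one]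
      _ = (2 : ℝ) ^ m * #S := by rw [sum_const, nsmul_eq_mul, mul_comm]
  rw [← key]
  refine sum_le_sum fun y _ => ?_
  calc signOf (g y) * ∑ x ∈ S, signOf (d x) * twist x y
      ≤ |signOf (g y) * ∑ x ∈ S, signOf (d x) * twist x y| := le_abs_self _
    _ = |∑ x ∈ S, signOf (d x) * twist x y| := by rw [abs_mul, abs_signOf, one_mul]

/-- **Plateau meets Parseval.**  If `D : ι → ℝ` takes, at every point, either the value `0` or a value of absolute size `≥ T`,
then `T · Σ_y |D(y)| ≤ Σ_y D(y)²`. [folklore] -/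
theorem kb_l1_le_of_gap {ι : Type*} [Fintype ι] (D : ι → ℝ) (T : ℝ) (h : ∀ y, D y = 0 ∨ T ≤ |D y|) :
    T * ∑ y, |D y| ≤ ∑ y, D y ^ 2 := by
  rw [mul_sum]
  refine sum_le_sum fun y _ => ?_
  rcases h y with h0 | hle
  · rw [h0]; simp
  · calc T * |D y| ≤ |D y| * |D y| := mul_le_mul_of_nonneg_right hle (abs_nonneg _)
      _ = D y ^ 2 := by rw [abs_mul_abs_self, pow_two]

/-- **Corollary (how the two meet).**  If `W_g = 2^m(−1)^d` and the partial transform `D_S(y) = Σ_{x∈S}(−1)^{d(x)+x·y}` only takes values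
in `{0} ∪ {|·| ≥ T}`, then `2^m·#S·T ≤ Σ_y D_S(y)²` (`= 2^n·#S` by Parseval, so `T ≤ 2^{n−m}`: a plateau height above `2^{n−m}` is
impossible).  [this work] -/
theorem kb_bent_gap_bound {m : ℕ} (g d : (Fin n → Bool) → Bool) (hd : ∀ x, W (fun y => signOf (g y)) x = (2 : ℝ) ^ m * signOf (d x))
    (S : Finset (Fin n → Bool)) (T : ℝ) (hT : 0 < T)
    (h : ∀ y, ∑ x ∈ S, signOf (d x) * twist x y = 0 ∨ T ≤ |∑ x ∈ S, signOf (d x) * twist x y|) :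
    (2 : ℝ) ^ m * #S * T ≤ ∑ y, (∑ x ∈ S, signOf (d x) * twist x y) ^ 2 := by
  have h1 := kb_bent_l1 g d hd S
  have h2 := kb_l1_le_of_gap (fun y => ∑ x ∈ S, signOf (d x) * twist x y) T h
  calc (2 : ℝ) ^ m * #S * T ≤ (∑ y, |∑ x ∈ S, signOf (d x) * twist x y|) * T :=
        mul_le_mul_of_nonneg_right h1 hT.le
    _ = T * ∑ y, |∑ x ∈ S, signOf (d x) * twist x y| := mul_comm _ _
    _ ≤ _ := h2

end Summit.QuantumAdvantage.QuantumAdvantage.Theorems.CubicForrelation.NearExactIsExact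

end
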